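import Summits.Ventures.DiscreteObjects.Hadamard.AutStructureSummary668B
import Summits.Ventures.DiscreteObjects.Hadamard.Order369Excluded668
import Summits.Ventures.DiscreteObjects.Hadamard.Order27TimesPrime668
import Summits.Ventures.DiscreteObjects.Hadamard.ThreePrimesOrder668
import Summits.Ventures.DiscreteObjects.Hadamard.CompositeOrderRankGen

/-!
# Hadamard 668 census, family F12 — the cyclic-subgroup exclusions of gen 18 in ONE statement (kernel summary C)

Framing: lottery ticket; floor = certified bounds/negative ranges.

Cell pub-namedobj (venture DiscreteObjects), target (H), hadamard gen 18.  Complements `AutStructureSummary668` (A,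
p319073) and `AutStructureSummary668B` (p323071).  For a Hadamard matrix `H` of order `668` and every signed
automorphism `(π, κ, d, e)` with pair order `N = orderOf (π, κ)`, **`hadamard668_aut_cyclic_exclusions`** lists the
orders that `N` is NOT divisible by (all kernel theorems of gens 11/17/18):
`49`, `125`, `25·q` (`q ∈ {7,11,13,23,37,41,83,167}`), `225`, `369`, `27·q` (`q ∈ {13,23,37}`), `385`, `429`.
(The gen-11 composite table — 31 products of two distinct primes — is conjunct 5 of summary A.)  Together with the
prime spectrum `{2,3,5,7,11,13,23,37,41,83,167}` these are, as of gen 18, exactly the odd cyclic orders that orbit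
counting under the kernel windows excludes (pub-namedobj-hadamard-g18/code/cyclic_orbit_types_g18.py); the odd orders
`9, 15, 21, 25, 27, 33, 35, 39, 45, 55, 63, 65, 69, 75, 77, 91, 99, 105, 111, 117, 123, 135, 143, 165, 189, 195, 207,
231, 273, 297, 333` survive the counting (structure statements where available).  NOTHING here excludes H(668) or
asserts that any automorphism exists; HITS 0/4.  Ours; no `sorry`, no definitions.
-/

namespace Summit.Ventures.DiscreteObjects.Hadamard

open Finset BigOperators Matrix

open Literature.Combinatorics.Designs.GoethalsSeidel (IsHadamardMatrix)

variable {ι : Type*} [Fintype ι] [DecidableEq ι]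

/-- **Cyclic-subgroup exclusions for Aut± H(668), kernel summary C** (see the module docstring). -/
theorem hadamard668_aut_cyclic_exclusions {H : Matrix ι ι ℤ} (hH : IsHadamardMatrix H)
    (hι : Fintype.card ι = 668) (π κ : Equiv.Perm ι) (d e : ι → ℤ) (haut : IsSignedAut H π κ d e) :
    ¬ 49 ∣ orderOf ((π, κ) : Equiv.Perm ι × Equiv.Perm ι) ∧
    ¬ 125 ∣ orderOf ((π, κ) : Equiv.Perm ι × Equiv.Perm ι) ∧
    (∀ q : ℕ, (q = 7 ∨ q = 11 ∨ q = 13 ∨ q = 23 ∨ q = 37 ∨ q = 41 ∨ q = 83 ∨ q = 167) →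
      ¬ 25 * q ∣ orderOf ((π, κ) : Equiv.Perm ι × Equiv.Perm ι)) ∧
    ¬ 225 ∣ orderOf ((π, κ) : Equiv.Perm ι × Equiv.Perm ι) ∧
    ¬ 369 ∣ orderOf ((π, κ) : Equiv.Perm ι × Equiv.Perm ι) ∧
    (∀ q : ℕ, (q = 13 ∨ q = 23 ∨ q = 37) → ¬ 27 * q ∣ orderOf ((π, κ) : Equiv.Perm ι × Equiv.Perm ι)) ∧
    ¬ 385 ∣ orderOf ((π, κ) : Equiv.Perm ι × Equiv.Perm ι) ∧
    ¬ 429 ∣ orderOf ((π, κ) : Equiv.Perm ι × Equiv.Perm ι) := by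
  refine ⟨?_, ?_, ?_, ?_, ?_, ?_, ?_, ?_⟩
  · intro h; exact hadamard668_signedAut_not_dvd_orderOf_49 hH hι π κ d e haut (by simpa using h)
  · intro h; exact hadamard668_signedAut_not_dvd_orderOf_125 hH hι π κ d e haut (by simpa using h)
  · intro q hq h; exact hadamard668_signedAut_not_dvd_orderOf_25q hH hι π κ d e haut hq h
  · intro h; exact hadamard668_signedAut_not_dvd_orderOf_225 hH hι π κ d e haut h
  · intro h; exact hadamard668_signedAut_not_dvd_orderOf_369 hH hι π κ d e haut h
  · intro q hq h; exact hadamard668_signedAut_not_dvd_orderOf_27q hH hι π κ d e haut hq h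
  · intro h; exact hadamard668_signedAut_not_dvd_orderOf_385 hH hι π κ d e haut h
  · intro h; exact hadamard668_signedAut_not_dvd_orderOf_429 hH hι π κ d e haut h

/-- **Bookkeeping complement** (verify-ref g107 finding, theorem content unchanged): the prime pair `(5, 41)` —
pair-order `205` — is excluded in the tree by `no_hadamard668_signedAut_order205` (`CompositeOrderRankGen`, gen 11)
but is not among the 31 pairs of conjunct 5 of `hadamard668_aut_structure_summary`; the excluded two-prime table
therefore has 32 entries.  Restated here in the `orderOf` form next to the other cyclic exclusions.  EXCLUSION of
an element order of a hypothetical H(668) only. -/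
theorem hadamard668_aut_cyclic_exclusions_205 {H : Matrix ι ι ℤ} (hH : IsHadamardMatrix H)
    (hι : Fintype.card ι = 668) (π κ : Equiv.Perm ι) (d e : ι → ℤ) (haut : IsSignedAut H π κ d e) :
    ¬ 205 ∣ orderOf ((π, κ) : Equiv.Perm ι × Equiv.Perm ι) := fun h =>
  no_hadamard668_signedAut_order205 hH hι π κ d e haut (by simpa using h)

end Summit.Ventures.DiscreteObjects.Hadamard
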